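import Mathlib
import Summits.PneNP.PneNP.Theorems.Nc03AvoidResidualCoreCandStarMain
import Summits.PneNP.PneNP.Theorems.Nc03AvoidResidualCoreCandStarFP
import Summits.PneNP.PneNP.Theorems.Nc03AvoidResidualCoreReductionCand

/-!
# Route Nc03AvoidResidualCore, crux `CandStarReduction` (X₂) — the split: tangled surplus or matching-class sub-instance

Helper file for `stmt-PneNP-19963` (sequel of `…CandStarMain` / `…CandStarFP`; cell pnp-ideate, rung F-N1b).
The "Consequently" of Thm B.1 of the cell memo pnp-ideate-p2/ROUND-3-ADDENDUM-B, with the disjoint-cherry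
threshold: given a polynomial-time avoider `f₁` for pure-`CAND` MATCHING-CLASS instances at stretch `C′`,
the raw solver `x2Out f₁` handles every pure-`CAND` instance with `n ≥ 1` inputs and `m ≥ (C′+2)·n` outputs:

* if `#tangled ≥ 2n+1` (counted on raw data by `tangB`, `tangB_iff`): the tangled-surplus solver `starOut`
  (`…CandStarMain.starOut_correct`);
* else the `≥ m − 2n ≥ C′·n` UNTANGLED outputs form a pure matching-class sub-instance on the same inputs
  (`…CandCherry.untangled_isMatchingClass`); its code is rebuilt (`Nc03Reduction.unparse`), `f₁` is called
  (`Nc03Reduction.sol13`) and its answer re-embedded (`splitOut`; `…CandCherry.not_mem_range_of_untangled`).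

Correctness `x2Out_correct`; polynomial time `codeFP_x2Solver` (from the input code, via the tree's parser
`Nc03Reduction.codeFP_toRaw`). The closing file `…CandStarReduction` only unfolds the route statement.

Restricted-model (NC⁰₃) range-avoidance rung F-N1b of the PneNP frontier ladder; no bearing on P vs NP.
-/

set_option linter.dupNamespace false -- `Summit.PneNP.PneNP.…`: summit = sub-problem name (D-0017 single-conjunct layout)

namespace Summit.PneNP.PneNP.Theorems.Nc03CandStar

open Finset
open Literature.Computability.Complexity CodeFP Nc03Reduction
open Summit.PneNP.PneNP.Theorems.Nc03AvoidResidualCoreCandFewHeadsRungFP (tri)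
open Summit.PneNP.PneNP.Theorems.Nc03AvoidResidualCoreCandMatchRungFP (codeFP_triI)
open Summit.PneNP.PneNP.Theorems.Nc03AvoidResidualCoreCandMatchRung (IsMatchingClass)
open Summit.PneNP.PneNP.Theorems.Nc03AvoidResidualCoreCandCherry (tangled mem_tangled not_mem_range_of_untangled)

/-! ## The program -/

/-- Tangledness test on raw data: another output with the same head shares a data variable. -/
def tangB (pr : PRaw) (j : ℕ) : Bool :=
  (List.range pr.2.1).any fun j' => !decide (j' = j) && decide ((tri pr.2.2 j').1 = (tri pr.2.2 j).1) &&
    (decide ((tri pr.2.2 j).2.1 = (tri pr.2.2 j').2.1) || decide ((tri pr.2.2 j).2.1 = (tri pr.2.2 j').2.2) ||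
      decide ((tri pr.2.2 j).2.2 = (tri pr.2.2 j').2.1) || decide ((tri pr.2.2 j).2.2 = (tri pr.2.2 j').2.2))

/-- The tangled outputs. -/
def tangL (pr : PRaw) : List ℕ := (List.range pr.2.1).filter (tangB pr)

/-- The untangled outputs (increasing). -/
def untL (pr : PRaw) : List ℕ := (List.range pr.2.1).filter fun j => !tangB pr j

/-- The raw form of the untangled sub-instance. -/
def subPR (pr : PRaw) : PRaw := (pr.1, (untL pr).length, (untL pr).map (tri pr.2.2))

/-- Keyed lookup of a bit (default `false`). -/
def lookupN (A : List (ℕ × Bool)) (o : ℕ) : Bool :=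
  match A.find? (fun t => decide (t.1 = o)) with
  | none => false
  | some t => t.2

/-- The matching-class branch: the oracle's answer on the untangled sub-instance, re-embedded. -/
def splitOut (f₁ : List Bool → List Bool) (pr : PRaw) : List Bool :=
  (List.range pr.2.1).map (lookupN ((untL pr).zip (sol13 f₁ (subPR pr))))

/-- **The raw solver of X₂**: tangled surplus ⇒ `starOut`, else the matching-class branch. -/
def x2Out (f₁ : List Bool → List Bool) (pr : PRaw) : List Bool :=
  if decide (2 * pr.1 + 1 ≤ (tangL pr).length) then starOut pr else splitOut f₁ pr

/-- The raw pure form of a parsed instance: drop the table bytes. -/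
def prOfRI (ri : RI) : PRaw := (ri.1, ri.2.1, ri.2.2.map fun r => (r.2.1, r.2.2.1, r.2.2.2))

/-! ## Reading -/

section Reading

variable {N M : ℕ} (J : LocalMap 3 N M)

/-- The parsed raw form projects to the raw pure form. -/
theorem prOfRI_toRaw : prOfRI (toRaw ⟨N, M, J⟩) = rawOf J := by
  unfold prOfRI toRaw rawOf
  simp only [List.map_ofFn]
  rfl

/-- **Reading the tangledness test.** -/
theorem tangB_iff (j : Fin M) : tangB (rawOf J) j.val = true ↔ j ∈ tangled J := by
  unfold tangB
  rw [mem_tangled, List.any_eq_true, rawOf_M]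
  constructor
  · rintro ⟨k, hk, h⟩
    rw [List.mem_range] at hk
    have e : tri (rawOf J).2.2 k = tripOf J ⟨k, hk⟩ := tri_rawOf J ⟨k, hk⟩
    simp only [e, tri_rawOf, tripOf, Bool.and_eq_true, Bool.not_eq_true', decide_eq_false_iff_not,
      decide_eq_true_eq, Bool.or_eq_true, Fin.val_inj] at h
    obtain ⟨⟨hne, hh⟩, hs⟩ := h
    refine ⟨⟨k, hk⟩, fun hj => hne (congrArg Fin.val hj), hh, ?_⟩
    rcases hs with ((h | h) | h) | h
    · exact ⟨1, 1, by decide, by decide, h⟩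
    · exact ⟨1, 2, by decide, by decide, h⟩
    · exact ⟨2, 1, by decide, by decide, h⟩
    · exact ⟨2, 2, by decide, by decide, h⟩
  · rintro ⟨j', hne, hh, a, b, ha, hb, hab⟩
    refine ⟨j'.val, List.mem_range.2 j'.isLt, ?_⟩
    simp only [tri_rawOf, tripOf, Bool.and_eq_true, Bool.not_eq_true', decide_eq_false_iff_not,
      decide_eq_true_eq, Bool.or_eq_true, Fin.val_inj]
    refine ⟨⟨hne, hh⟩, ?_⟩
    rcases role_cases ha with rfl | rfl <;> rcases role_cases hb with rfl | rfl
    · exact Or.inl (Or.inl (Or.inl hab))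
    · exact Or.inl (Or.inl (Or.inr hab))
    · exact Or.inl (Or.inr hab)
    · exact Or.inr hab

/-- **The tangled count read on raw data is `#(tangled J)`.** -/
theorem length_tangL : (tangL (rawOf J)).length = #(tangled J) := by
  have hmap : (tangled J).map Fin.valEmbedding = (tangL (rawOf J)).toFinset := by
    ext k
    unfold tangL
    rw [Finset.mem_map, List.mem_toFinset, List.mem_filter, List.mem_range, rawOf_M]
    constructor
    · rintro ⟨j, hj, rfl⟩
      exact ⟨j.isLt, (tangB_iff J j).2 hj⟩
    · rintro ⟨hk, ht⟩
      exact ⟨⟨k, hk⟩, (tangB_iff J ⟨k, hk⟩).1 ht, rfl⟩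
  have hnd : (tangL (rawOf J)).Nodup := by unfold tangL; exact List.nodup_range.filter _
  rw [← Finset.card_map Fin.valEmbedding, hmap, List.toFinset_card_of_nodup hnd]

/-- Tangled and untangled outputs together are all outputs. -/
theorem length_untL_add (pr : PRaw) : (untL pr).length + (tangL pr).length = pr.2.1 := by
  unfold untL tangL
  have h := List.length_eq_length_filter_add (l := List.range pr.2.1) (tangB pr)
  rw [List.length_range] at h
  omega

/-- The untangled list is duplicate-free. -/
theorem nodup_untL (pr : PRaw) : (untL pr).Nodup := by unfold untL; exact List.nodup_range.filter _

/-- Members of the untangled list are untangled outputs. -/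
theorem mem_untL_iff (j : Fin M) : j.val ∈ untL (rawOf J) ↔ j ∉ tangled J := by
  unfold untL
  rw [List.mem_filter, List.mem_range, rawOf_M, ← tangB_iff]
  simp [j.isLt]

/-- Members of the untangled list are output indices. -/
theorem lt_of_mem_untL {k : ℕ} (hk : k ∈ untL (rawOf J)) : k < M := by
  unfold untL at hk
  rw [List.mem_filter, List.mem_range, rawOf_M] at hk
  exact hk.1

/-- The enumeration of the untangled outputs. -/
def untIdx (i : Fin (untL (rawOf J)).length) : Fin M :=
  ⟨(untL (rawOf J))[i.val], lt_of_mem_untL J (List.getElem_mem i.isLt)⟩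

/-- The enumeration is injective. -/
theorem untIdx_injective : Function.Injective (untIdx J) := by
  intro i i' h
  have h' : (untL (rawOf J))[i.val]'i.isLt = (untL (rawOf J))[i'.val]'i'.isLt := congrArg Fin.val h
  exact Fin.ext ((nodup_untL (rawOf J)).getElem_inj_iff.1 h')

/-- The enumerated outputs are untangled. -/
theorem untIdx_not_mem (i : Fin (untL (rawOf J)).length) : untIdx J i ∉ tangled J :=
  (mem_untL_iff J (untIdx J i)).1 (List.getElem_mem i.isLt)

/-- **The rebuilt raw form is the raw form of the untangled sub-instance.** -/
theorem rawOf_restrict_untIdx : rawOf (restrict J (untIdx J)) = subPR (rawOf J) := by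
  unfold subPR
  rw [rawOf_eq, rawOf_N]
  congr 1; congr 1
  rw [← List.ofFn_getElem_eq_map]
  congr 1
  funext i
  show tripOf (restrict J (untIdx J)) i = tri (rawOf J).2.2 (untIdx J i).val
  rw [tri_rawOf]
  rfl

/-- Keyed lookup in a duplicate-free key list zipped with values. -/
theorem lookupN_zip {K : List ℕ} (hK : K.Nodup) {zl : List Bool} (hl : zl.length = K.length) (i : ℕ)
    (hi : i < K.length) : lookupN (K.zip zl) (K[i]'hi) = zl[i]'(hl ▸ hi) := by
  have hiz : i < (K.zip zl).length := by rw [List.length_zip, hl, min_self]; exact hi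
  have hfind : (K.zip zl).find? (fun t => decide (t.1 = K[i]'hi)) = some (K[i]'hi, zl[i]'(hl ▸ hi)) := by
    rw [List.find?_eq_some_iff_getElem]
    refine ⟨by simp, i, hiz, by rw [List.getElem_zip], fun j hj => ?_⟩
    have hjK : j < K.length := lt_trans hj hi
    rw [List.getElem_zip]
    simp only [Bool.not_eq_true', decide_eq_false_iff_not]
    intro h
    exact absurd (hK.getElem_inj_iff.1 h) (Nat.ne_of_lt hj)
  unfold lookupN
  rw [hfind]

/-- Reading the matching-class branch at an untangled output: the oracle's bit. -/
theorem splitOut_untIdx (f₁ : List Bool → List Bool) (i : Fin (untL (rawOf J)).length) :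
    (splitOut f₁ (rawOf J)).getD (untIdx J i).val false =
      readOut (untL (rawOf J)).length (f₁ (unparse (subPR (rawOf J)))) i := by
  unfold splitOut readOut
  rw [rawOf_M, List.getD_eq_getElem?_getD, List.getElem?_map, List.getElem?_range (untIdx J i).isLt,
    Option.map_some, Option.getD_some]
  show lookupN ((untL (rawOf J)).zip (sol13 f₁ (subPR (rawOf J)))) ((untL (rawOf J))[i.val]) = _
  have hl : (sol13 f₁ (subPR (rawOf J))).length = (untL (rawOf J)).length := by
    rw [length_sol13]; rfl
  rw [lookupN_zip (nodup_untL _) hl i.val i.isLt]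
  unfold sol13
  rw [List.getD_eq_getElem?_getD, List.getElem_map, List.getElem_range]
  rfl

/-! ## Correctness -/

/-- **The matching-class branch is correct** when the untangled sub-instance is long enough for the
oracle. -/
theorem splitOut_correct (hI : J.IsPure candPred) {f₁ : List Bool → List Bool} {C' : ℕ}
    (hf₁ : ∀ n m (I : LocalMap 3 n m), I.IsPure candPred ∧ IsMatchingClass I → 0 < n → C' * n ≤ m →
      readOut m (f₁ I.encode) ∉ I.range)
    (hN : 0 < N) (hm' : C' * N ≤ (untL (rawOf J)).length) :
    (fun o : Fin M => (splitOut f₁ (rawOf J)).getD o.val false) ∉ J.range := by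
  set I' := restrict J (untIdx J) with hI'
  have hpure : I'.IsPure candPred := Nc03AvoidResidualCoreCandCherry.restrict_isPure hI _
  have hmatch : IsMatchingClass I' :=
    Nc03AvoidResidualCoreCandCherry.untangled_isMatchingClass J _ (untIdx_injective J) (untIdx_not_mem J)
  have havoid := hf₁ N _ I' ⟨hpure, hmatch⟩ hN hm'
  have henc : I'.encode = unparse (subPR (rawOf J)) := by
    rw [← unparse_rawOf I' hpure, hI', rawOf_restrict_untIdx]
  refine (not_mem_range_of_untangled hI (untIdx J) (untIdx_injective J) (untIdx_not_mem J) ?_).1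
  have e : (fun i => (splitOut f₁ (rawOf J)).getD (untIdx J i).val false) =
      readOut (untL (rawOf J)).length (f₁ I'.encode) := by
    funext i; rw [splitOut_untIdx, henc]
  rw [e]
  exact havoid

/-- **Correctness of the raw solver of X₂** at stretch `C′ + 2`. -/
theorem x2Out_correct (hI : J.IsPure candPred) {f₁ : List Bool → List Bool} {C' : ℕ}
    (hf₁ : ∀ n m (I : LocalMap 3 n m), I.IsPure candPred ∧ IsMatchingClass I → 0 < n → C' * n ≤ m →
      readOut m (f₁ I.encode) ∉ I.range)
    (hN : 0 < N) (hM : (C' + 2) * N ≤ M) :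
    (fun o : Fin M => (x2Out f₁ (rawOf J)).getD o.val false) ∉ J.range := by
  unfold x2Out
  by_cases h : 2 * (rawOf J).1 + 1 ≤ (tangL (rawOf J)).length
  · rw [decide_eq_true h, if_pos rfl]
    rw [rawOf_N, length_tangL] at h
    exact starOut_correct J hI h
  · rw [decide_eq_false h]
    simp only [Bool.false_eq_true, ↓reduceIte]
    refine splitOut_correct J hI hf₁ hN ?_
    have hadd := length_untL_add (rawOf J)
    rw [rawOf_M] at hadd
    rw [rawOf_N] at h
    have : C' * N + 2 * N ≤ M := by rw [← Nat.add_mul]; exact hM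
    omega

end Reading

/-! ## Polynomial time -/

section PolyTime

variable {α : Type} {eα : α → List Bool}

/-- The tangledness test. -/
theorem codeFP_tangB : CodeFP (pairE prE natE) bitE (fun q => tangB q.1 q.2) := by
  -- the `any` predicate sees `((triples, j), j')`
  have hL : CodeFP (pairE (pairE (rawE tripE) natE) natE) (rawE tripE) (fun s => s.1.1) := (fst _ _).fst'
  have hj : CodeFP (pairE (pairE (rawE tripE) natE) natE) natE (fun s => s.1.2) := (fst _ _).snd'
  have hj' : CodeFP (pairE (pairE (rawE tripE) natE) natE) natE (fun s => s.2) := snd _ _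
  have hne := (codeFP_eqTest hj' hj).not
  have hh := codeFP_eqTest (codeFP_tri0 hL hj') (codeFP_tri0 hL hj)
  have e11 := codeFP_eqTest (codeFP_tri1 hL hj) (codeFP_tri1 hL hj')
  have e12 := codeFP_eqTest (codeFP_tri1 hL hj) (codeFP_tri2 hL hj')
  have e21 := codeFP_eqTest (codeFP_tri2 hL hj) (codeFP_tri1 hL hj')
  have e22 := codeFP_eqTest (codeFP_tri2 hL hj) (codeFP_tri2 hL hj')
  have hp : CodeFP (pairE (pairE (rawE tripE) natE) natE) bitE
      (fun s => !decide (s.2 = s.1.2) && decide ((tri s.1.1 s.2).1 = (tri s.1.1 s.1.2).1) &&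
        (decide ((tri s.1.1 s.1.2).2.1 = (tri s.1.1 s.2).2.1) || decide ((tri s.1.1 s.1.2).2.1 = (tri s.1.1 s.2).2.2) ||
          decide ((tri s.1.1 s.1.2).2.2 = (tri s.1.1 s.2).2.1) || decide ((tri s.1.1 s.1.2).2.2 = (tri s.1.1 s.2).2.2))) :=
    ((hne.and hh).and (((e11.or e12).or e21).or e22)).congr fun _ => rfl
  have hctx : CodeFP (pairE prE natE) (pairE (pairE (rawE tripE) natE) (rawE natE))
      (fun q => ((q.1.2.2, q.2), List.range q.1.2.1)) :=
    ((codeFP_trips.comp (fst _ _)).pair (snd _ _)).pair (urange.comp (codeFP_M.comp (fst _ _)))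
  exact ((any hp).comp hctx).congr fun _ => rfl

/-- The tangled outputs. -/
theorem codeFP_tangL : CodeFP prE (rawE natE) tangL :=
  ((filter codeFP_tangB).comp ((CodeFP.id prE).pair (urange.comp codeFP_M))).congr fun _ => rfl

/-- The untangled outputs. -/
theorem codeFP_untL : CodeFP prE (rawE natE) untL :=
  ((filter codeFP_tangB.not).comp ((CodeFP.id prE).pair (urange.comp codeFP_M))).congr fun _ => rfl

/-- The raw form of the untangled sub-instance. -/
theorem codeFP_subPR : CodeFP prE prE subPR := by
  have htr : CodeFP (pairE (rawE tripE) (rawE natE)) (rawE tripE) (fun q => q.2.map fun a => tri q.1 a) :=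
    map (codeFP_triI (fst _ _) (snd _ _))
  exact (codeFP_N.pair (((ulength natE).comp codeFP_untL).pair (htr.comp (codeFP_trips.pair codeFP_untL)))).congr
    fun _ => rfl

/-- The keyed lookup. -/
theorem codeFP_lookupN : CodeFP (pairE (rawE (pairE natE bitE)) natE) bitE (fun q => lookupN q.1 q.2) := by
  have hp : CodeFP (pairE natE (pairE natE bitE)) bitE (fun s => decide (s.2.1 = s.1)) :=
    codeFP_eqTest (snd _ _).fst' (fst _ _)
  have hfind : CodeFP (pairE (rawE (pairE natE bitE)) natE) (optE (pairE natE bitE))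
      (fun q => q.1.find? fun t => decide (t.1 = q.2)) :=
    ((rawFind? hp).comp ((snd _ _).pair (fst _ _))).congr fun _ => rfl
  have hk := optCases (σ := Unit) (eσ := unitE) (eα := pairE natE bitE) (eδ := bitE)
    (k := fun _ o => match o with | none => false | some t => t.2)
    (gnone := fun _ => false) (gsome := fun t => t.2.2) (const unitE false) (snd _ _).snd'
    (fun _ => rfl) (fun _ _ => rfl)
  exact (hk.comp ((const _ ()).pair hfind)).congr fun _ => rfl

/-- The matching-class branch, relative to a polynomial-time oracle. -/
theorem codeFP_splitOut {f₁ : List Bool → List Bool} (hf₁ : IsPolyTime f₁) : CodeFP prE (rawE bitE) (splitOut f₁) := by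
  have hA : CodeFP prE (rawE (pairE natE bitE)) (fun pr => (untL pr).zip (sol13 f₁ (subPR pr))) :=
    (rawZip natE bitE).comp (codeFP_untL.pair ((codeFP_sol13 hf₁).comp codeFP_subPR))
  exact ((map codeFP_lookupN).comp (hA.pair (urange.comp codeFP_M))).congr fun _ => rfl

/-- **The raw solver of X₂ is polynomial time**, relative to a polynomial-time oracle. -/
theorem codeFP_x2Out {f₁ : List Bool → List Bool} (hf₁ : IsPolyTime f₁) : CodeFP prE (rawE bitE) (x2Out f₁) := by
  have hthr : CodeFP prE natE (fun pr => 2 * pr.1 + 1) :=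
    (natOfUn.comp (unSucc.comp ((unMulConst 2).comp codeFP_N))).congr fun _ => rfl
  have hcnt : CodeFP prE natE (fun pr => (tangL pr).length) := (natLength natE).comp codeFP_tangL
  have htest : CodeFP prE bitE (fun pr => decide (2 * pr.1 + 1 ≤ (tangL pr).length)) :=
    (natLe.comp (hthr.pair hcnt)).congr fun _ => rfl
  exact (htest.ite codeFP_starOut (codeFP_splitOut hf₁)).congr fun _ => rfl

/-- The projection of the parsed raw form is polynomial time. -/
theorem codeFP_prOfRI : CodeFP riE prE prOfRI := by
  have hrec : CodeFP recE tripE (fun r => (r.2.1, r.2.2.1, r.2.2.2)) :=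
    (natOfUn.comp (snd _ _).fst').pair ((natOfUn.comp (snd _ _).snd'.fst').pair (natOfUn.comp (snd _ _).snd'.snd'))
  have h3 : CodeFP riE (rawE tripE) (fun ri => ri.2.2.map fun r => (r.2.1, r.2.2.1, r.2.2.2)) :=
    (map₀ hrec).comp (snd _ _).snd'
  exact ((fst _ _).pair ((snd _ _).fst'.pair h3)).congr fun _ => rfl

/-- **The solver of X₂, from input codes to output strings, is polynomial time** (oracle in FP). -/
theorem codeFP_x2Solver {f₁ : List Bool → List Bool} (hf₁ : IsPolyTime f₁) :
    CodeFP eIn strE (fun x => x2Out f₁ (prOfRI (toRaw x))) :=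
  (bitsToStr.comp ((codeFP_x2Out hf₁).comp (codeFP_prOfRI.comp codeFP_toRaw))).congr fun _ => rfl

end PolyTime

end Summit.PneNP.PneNP.Theorems.Nc03CandStar
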